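import Mathlib
import HarnessLib
import Summits.HubbardSuperconductivity.HubbardSuperconductivity.Theorems.KLProgrammeKLRegimeSliceSymbolTorus

/-!
# Route `KLProgramme` — engine support (route (L2)): the tangential datum travels two lattice steps — the frame band's directional derivative
# at a point near the sector support, and the propagator's differences ON THE NEIGHBOURHOOD OF A MULTIPLIER SUPPORT

Cell `gate-hubbard-kl`, seat hubbard-kl-k3c2-p3 (row «sector-counting import (DR2000 L11/L12) for the leg-dress bar»), for the ENGINE child
(gen 3 stmt-HubbardSuperconductivity-19823, gen 4 stmt-HubbardSuperconductivity-19855 `KLRegimeEngineV12`, `stub_engine_step_norms`: propagator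
constant `α_n`).  The per-pair assembly `KLProgrammeKLRegimeSectorSliceCharSum.norm_fwdDiff_iter_two_smul_mul_le_of_support` needs the slice profile's
differences along `w` only at points `q` with `M(q + j•w) ≠ 0` for some `j ≤ 2` (`M` = multiplier product); the anisotropic input there is the
tangential smallness `|De_K(c(q₂))·w| ≤ τ` which the p4 lineage certifies ON the support (sector cell).  Here it is moved to the
two-step neighbourhood at the cost `2K₂‖w‖²`:

* `frameLevel_add_toLp_intCast`, **`fderiv_frameLevel_periodic`** — `2πℤ²`-periodicity of `De_K`;
* **`abs_fderiv_frameLevel_centred_le_of_shift`** — `|De_K(c(k))·w| ≤ |De_K(c(k + j•r̄))·w| + j·K₂‖w‖²` (`w = (2π/L)·r`);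
* **`abs_fderiv_frameLevel_le_of_near_support`** — if `|De_K(c(q'₂))·w| ≤ τ` wherever `M q' ≠ 0`, then `|De_K(c(q₂))·w| ≤ τ + 2K₂‖w‖²`
  wherever `M(q + j•(0,r̄)) ≠ 0` for some `j ≤ 2`;
* **`norm_fwdDiff_two_space_sliceSymbolTorus_le_of_near_support`**, `norm_fwdDiff_space_sliceSymbolTorus_le_of_near_support` — the propagator's
  first/second spatial differences on that neighbourhood with the constant tangential datum `τ + 2K₂‖w‖²` in place of the pointwise one.

Everything is proved; no definitions, no named facts. [folklore]

References: G. Benfatto, A. Giuliani, V. Mastropietro, Ann. Henri Poincaré 7 (2006) 809–898, Lemma 2.2, (2.36aa) and footnote ¹.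
-/

noncomputable section

namespace Summit.HubbardSuperconductivity.HubbardSuperconductivity.Theorems.TorusFourierL2

set_option linter.dupNamespace false -- summit = problem name (single-conjunct summit), D-0017

open Set Complex Finset Literature.MathematicalPhysics.QuantumLattice Literature.Probability.LatticeModels
open Summit.HubbardSuperconductivity.HubbardSuperconductivity.Theorems.DispersionFlow
open scoped Real

/-! ### §1 Periodicity of the derivative of the frame band -/

section Periodic

variable {L : ℕ} [NeZero L]

omit [NeZero L] in
/-- Translating by a reciprocal vector does not change the frame band: `e_K(x + toLp(2πm)) = e_K(x)`. [folklore] -/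
theorem frameLevel_add_toLp_intCast (μ : ℝ) (K : TrigPolyC4v) (x : EuclideanSpace ℝ (Fin 2)) (m : Fin 2 → ℤ) :
    frameLevel μ K (x + WithLp.toLp 2 (fun i => 2 * π * (m i : ℝ))) = frameLevel μ K x := by
  have h := frameLevel_toLp_periodic μ K (WithLp.ofLp x) m
  have e : (WithLp.toLp 2 (fun i => (WithLp.ofLp x) i + 2 * π * (m i : ℝ)) : EuclideanSpace ℝ (Fin 2)) =
      x + WithLp.toLp 2 (fun i => 2 * π * (m i : ℝ)) := by
    rw [← WithLp.toLp_add]; rfl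
  rw [e] at h
  rw [h]

omit [NeZero L] in
/-- **The derivative of the frame band is `2πℤ²`-periodic.** [folklore] -/
theorem fderiv_frameLevel_periodic (μ : ℝ) (K : TrigPolyC4v) (x : EuclideanSpace ℝ (Fin 2)) (m : Fin 2 → ℤ) :
    fderiv ℝ (frameLevel μ K) (x + WithLp.toLp 2 (fun i => 2 * π * (m i : ℝ))) = fderiv ℝ (frameLevel μ K) x := by
  have hfun : (fun y => frameLevel μ K (y + WithLp.toLp 2 (fun i => 2 * π * (m i : ℝ)))) = frameLevel μ K :=
    funext fun y => frameLevel_add_toLp_intCast μ K y m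
  rw [← fderiv_comp_add_right, hfun]

/-- **The directional derivative at a torus momentum versus at its translate**: for an integer vector `r`, `j : ℕ`, `w = toLp((2π/L)·r)` and a
frame band with `‖D²e_K‖ ≤ K₂`: `|De_K(c(k))·w| ≤ |De_K(c(k + j•r̄))·w| + j·K₂‖w‖²`. [folklore] -/
theorem abs_fderiv_frameLevel_centred_le_of_shift (μ : ℝ) (K : TrigPolyC4v) {K₂ : ℝ}
    (hK₂ : ∀ p, ‖iteratedFDeriv ℝ 2 (frameLevel μ K) p‖ ≤ K₂) (k : TorusSite 2 L) (r : Fin 2 → ℤ) (j : ℕ) :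
    |fderiv ℝ (frameLevel μ K) (WithLp.toLp 2 (torusCentredMomentum L k)) (WithLp.toLp 2 (fun i => 2 * π / L * (r i : ℝ)))| ≤
      |fderiv ℝ (frameLevel μ K) (WithLp.toLp 2 (torusCentredMomentum L (k + j • fun i => ((r i : ℤ) : ZMod L))))
          (WithLp.toLp 2 (fun i => 2 * π / L * (r i : ℝ)))| +
        j * (K₂ * ‖(WithLp.toLp 2 (fun i => 2 * π / L * (r i : ℝ)) : EuclideanSpace ℝ (Fin 2))‖ ^ 2) := by
  set q : EuclideanSpace ℝ (Fin 2) := WithLp.toLp 2 (torusCentredMomentum L k) with hq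
  set w : EuclideanSpace ℝ (Fin 2) := WithLp.toLp 2 (fun i => 2 * π / L * (r i : ℝ)) with hw
  -- the translate, read through the continuum band, is `q + j•w` up to a reciprocal vector
  have hsmul : (j • fun i => ((r i : ℤ) : ZMod L)) = fun i => (((j * r i : ℤ) : ℤ) : ZMod L) := by
    funext i; simp [nsmul_eq_mul]
  obtain ⟨m, hm⟩ := torusCentredMomentum_add_intCast k (fun i => (j : ℤ) * r i)
  have hpt : (WithLp.toLp 2 (torusCentredMomentum L (k + j • fun i => ((r i : ℤ) : ZMod L))) : EuclideanSpace ℝ (Fin 2)) =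
      (q + (j : ℝ) • w) + WithLp.toLp 2 (fun i => 2 * π * (m i : ℝ)) := by
    rw [hsmul, hm, hq, hw, ← WithLp.toLp_smul, ← WithLp.toLp_add, ← WithLp.toLp_add]
    congr 1
    funext i
    simp only [Pi.add_apply, Pi.smul_apply, smul_eq_mul]
    push_cast
    ring
  rw [hpt, fderiv_frameLevel_periodic]
  have h := abs_fderiv_line_sub_le (EngineV8.contDiff_frameLevel μ K) hK₂ q w (j : ℝ)
  rw [Nat.abs_cast] at h
  have := abs_sub_abs_le_abs_sub (fderiv ℝ (frameLevel μ K) q w) (fderiv ℝ (frameLevel μ K) (q + (j : ℝ) • w) w)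
  rw [abs_sub_comm] at this
  linarith

end Periodic

/-! ### §2 The tangential datum and the propagator's differences on the two-step neighbourhood of a support -/

section Nbhd

variable {L M : ℕ} [NeZero L] [NeZero M] {c Λ Λ' β μ : ℝ} {K : TrigPolyC4v}

omit [NeZero M] in
/-- **The tangential datum on the two-step neighbourhood**: if `|De_K(c(q'₂))·w| ≤ τ` wherever `M q' ≠ 0`, then
`|De_K(c(q₂))·w| ≤ τ + 2K₂‖w‖²` at every `q` with `M(q + j•(0,r̄)) ≠ 0` for some `j ≤ 2`. [folklore] -/
theorem abs_fderiv_frameLevel_le_of_near_support {K₂ : ℝ} (hK₂ : ∀ p, ‖iteratedFDeriv ℝ 2 (frameLevel μ K) p‖ ≤ K₂)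
    (Mf : TorusSite 1 (2 * M) × TorusSite 2 L → ℂ) (r : Fin 2 → ℤ) {τ : ℝ}
    (hτ : ∀ q', Mf q' ≠ 0 → |fderiv ℝ (frameLevel μ K) (WithLp.toLp 2 (torusCentredMomentum L q'.2))
      (WithLp.toLp 2 (fun i => 2 * π / L * (r i : ℝ)))| ≤ τ)
    (q : TorusSite 1 (2 * M) × TorusSite 2 L)
    (hq : ∃ j : ℕ, j ≤ 2 ∧ Mf (q + j • ((0 : TorusSite 1 (2 * M)), (fun i => ((r i : ℤ) : ZMod L)))) ≠ 0) :
    |fderiv ℝ (frameLevel μ K) (WithLp.toLp 2 (torusCentredMomentum L q.2)) (WithLp.toLp 2 (fun i => 2 * π / L * (r i : ℝ)))| ≤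
      τ + 2 * (K₂ * ‖(WithLp.toLp 2 (fun i => 2 * π / L * (r i : ℝ)) : EuclideanSpace ℝ (Fin 2))‖ ^ 2) := by
  obtain ⟨j, hj, hne⟩ := hq
  have hK0 : 0 ≤ K₂ := le_trans (norm_nonneg _) (hK₂ 0)
  have h1 := abs_fderiv_frameLevel_centred_le_of_shift μ K hK₂ q.2 r j
  have h2 := hτ _ hne
  have e : (q + j • ((0 : TorusSite 1 (2 * M)), (fun i => ((r i : ℤ) : ZMod L)))).2 = q.2 + j • fun i => ((r i : ℤ) : ZMod L) := by
    simp [Prod.smul_mk]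
  rw [e] at h2
  have hj' : (j : ℝ) * (K₂ * ‖(WithLp.toLp 2 (fun i => 2 * π / L * (r i : ℝ)) : EuclideanSpace ℝ (Fin 2))‖ ^ 2) ≤
      2 * (K₂ * ‖(WithLp.toLp 2 (fun i => 2 * π / L * (r i : ℝ)) : EuclideanSpace ℝ (Fin 2))‖ ^ 2) := by
    have : (j : ℝ) ≤ 2 := by exact_mod_cast hj
    exact mul_le_mul_of_nonneg_right this (by positivity)
  linarith

/-- **Second spatial difference of the slice profile on the two-step neighbourhood of a support** with the constant tangential datum:
`‖(Δ_{(0,r̄)})² Ψ (q)‖ ≤ (32B₂+144B₁+128)(c/Λ³)(τ + 4K₂‖w‖²)² + (16B₁+16)(c/Λ²)K₂‖w‖²`. [cite: BenfattoGiulianiMastropietro2006, Lemma 2.2 (2.36aa)] -/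
theorem norm_fwdDiff_two_space_sliceSymbolTorus_le_of_near_support {K₂ : ℝ} (hK₂ : ∀ p, ‖iteratedFDeriv ℝ 2 (frameLevel μ K) p‖ ≤ K₂)
    (hΛ : 0 < Λ) (hΛΛ' : Λ ≤ Λ') (hc : 0 ≤ c) {B₁ B₂ : ℝ} (hB₁ : ∀ x, |deriv salmhoferCutoff x| ≤ B₁)
    (hB₂ : ∀ x, |deriv (deriv salmhoferCutoff) x| ≤ B₂) (Mf : TorusSite 1 (2 * M) × TorusSite 2 L → ℂ) (r : Fin 2 → ℤ) {τ : ℝ}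
    (hτ : ∀ q', Mf q' ≠ 0 → |fderiv ℝ (frameLevel μ K) (WithLp.toLp 2 (torusCentredMomentum L q'.2))
      (WithLp.toLp 2 (fun i => 2 * π / L * (r i : ℝ)))| ≤ τ)
    (q : TorusSite 1 (2 * M) × TorusSite 2 L)
    (hq : ∃ j : ℕ, j ≤ 2 ∧ Mf (q + j • ((0 : TorusSite 1 (2 * M)), (fun i => ((r i : ℤ) : ZMod L)))) ≠ 0) :
    ‖((fwdDiff ((0 : TorusSite 1 (2 * M)), (fun i => ((r i : ℤ) : ZMod L))))^[2]
        (fun q : TorusSite 1 (2 * M) × TorusSite 2 L =>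
          sliceSymbolFnXi c 0 Λ Λ' (matsubaraFreq β M ⟨(q.1 0).val, ZMod.val_lt (q.1 0)⟩) (nambuXiCT L μ K q.2))) q‖ ≤
      (32 * B₂ + 144 * B₁ + 128) * c / Λ ^ 3 *
          (τ + 4 * (K₂ * ‖(WithLp.toLp 2 (fun i => 2 * π / L * (r i : ℝ)) : EuclideanSpace ℝ (Fin 2))‖ ^ 2)) ^ 2 +
        (16 * B₁ + 16) * c / Λ ^ 2 * (K₂ * ‖(WithLp.toLp 2 (fun i => 2 * π / L * (r i : ℝ)) : EuclideanSpace ℝ (Fin 2))‖ ^ 2) := by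
  have hB10 : 0 ≤ B₁ := (abs_nonneg _).trans (hB₁ 0)
  have hB20 : 0 ≤ B₂ := (abs_nonneg _).trans (hB₂ 0)
  have hK0 : 0 ≤ K₂ := le_trans (norm_nonneg _) (hK₂ 0)
  have h := norm_fwdDiff_two_space_sliceSymbolTorus_le (c := c) (β := β) (μ := μ) (K := K) hK₂ hΛ hΛΛ' hc hB₁ hB₂ r q
  have hτ' := abs_fderiv_frameLevel_le_of_near_support hK₂ Mf r hτ q hq
  refine h.trans (add_le_add (mul_le_mul_of_nonneg_left ?_ (by positivity)) le_rfl)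
  have hsum : |fderiv ℝ (frameLevel μ K) (WithLp.toLp 2 (torusCentredMomentum L q.2)) (WithLp.toLp 2 (fun i => 2 * π / L * (r i : ℝ)))| +
      2 * (K₂ * ‖(WithLp.toLp 2 (fun i => 2 * π / L * (r i : ℝ)) : EuclideanSpace ℝ (Fin 2))‖ ^ 2) ≤
      τ + 4 * (K₂ * ‖(WithLp.toLp 2 (fun i => 2 * π / L * (r i : ℝ)) : EuclideanSpace ℝ (Fin 2))‖ ^ 2) := by linarith
  exact pow_le_pow_left₀ (by positivity) hsum 2

/-- **First spatial difference on the neighbourhood**: `‖Δ_{(0,r̄)} Ψ (q)‖ ≤ (16B₁+16)(c/Λ²)(τ + 3K₂‖w‖²)` wherever `M(q + j•(0,r̄)) ≠ 0` for some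
`j ≤ 2`. [cite: BenfattoGiulianiMastropietro2006, Lemma 2.2 (2.36aa)] -/
theorem norm_fwdDiff_space_sliceSymbolTorus_le_of_near_support {K₂ : ℝ} (hK₂ : ∀ p, ‖iteratedFDeriv ℝ 2 (frameLevel μ K) p‖ ≤ K₂)
    (hΛ : 0 < Λ) (hΛΛ' : Λ ≤ Λ') (hc : 0 ≤ c) {B₁ : ℝ} (hB₁ : ∀ x, |deriv salmhoferCutoff x| ≤ B₁)
    (Mf : TorusSite 1 (2 * M) × TorusSite 2 L → ℂ) (r : Fin 2 → ℤ) {τ : ℝ}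
    (hτ : ∀ q', Mf q' ≠ 0 → |fderiv ℝ (frameLevel μ K) (WithLp.toLp 2 (torusCentredMomentum L q'.2))
      (WithLp.toLp 2 (fun i => 2 * π / L * (r i : ℝ)))| ≤ τ)
    (q : TorusSite 1 (2 * M) × TorusSite 2 L)
    (hq : ∃ j : ℕ, j ≤ 2 ∧ Mf (q + j • ((0 : TorusSite 1 (2 * M)), (fun i => ((r i : ℤ) : ZMod L)))) ≠ 0) :
    ‖fwdDiff ((0 : TorusSite 1 (2 * M)), (fun i => ((r i : ℤ) : ZMod L)))
        (fun q : TorusSite 1 (2 * M) × TorusSite 2 L =>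
          sliceSymbolFnXi c 0 Λ Λ' (matsubaraFreq β M ⟨(q.1 0).val, ZMod.val_lt (q.1 0)⟩) (nambuXiCT L μ K q.2)) q‖ ≤
      (16 * B₁ + 16) * c / Λ ^ 2 *
        (τ + 3 * (K₂ * ‖(WithLp.toLp 2 (fun i => 2 * π / L * (r i : ℝ)) : EuclideanSpace ℝ (Fin 2))‖ ^ 2)) := by
  have hB10 : 0 ≤ B₁ := (abs_nonneg _).trans (hB₁ 0)
  have h := norm_fwdDiff_space_sliceSymbolTorus_le (c := c) (β := β) (μ := μ) (K := K) hK₂ hΛ hΛΛ' hc hB₁ r q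
  have hτ' := abs_fderiv_frameLevel_le_of_near_support hK₂ Mf r hτ q hq
  refine h.trans (mul_le_mul_of_nonneg_left ?_ (by positivity))
  linarith

end Nbhd

end Summit.HubbardSuperconductivity.HubbardSuperconductivity.Theorems.TorusFourierL2

end
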